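import Summits.ResolutionOfSingularities.ResolutionOfSingularities.Theorems.BandCutLaw
import HarnessLib

/-!
# BandCutThreads — decomp-res node «BandCut» (lens-5 g33, critic row 205 BOOKED 0 (law banked by name); optional
landing rider INBOX 2026-08-31T09:55:54Z), tree file 2/3 of the node

Content VERBATIM from the decomp-res lens-5 g33 node «BandCut» (818612f8), landing shape
`HOME/decomp-res-lens-5/g33/landing/BandCutLaw.lean` (6d3d9ad4) / `landing/BandCutThreads.lean` (651016ec) (shas =
NODE/PIN STATUS 09:47:52Z = CRITIC-LEDGER row 205); HOME = run/shared/lean/pub/decomp-res; critic row 205 BOOKED 0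
with the law banked BY NAME; landing = optional rider INBOX 2026-08-31T09:55:54Z — provenance and critic text in
full in the first file of the node, `BandCutLaw`.  `--kind proof --supports stmt-ResolutionOfSingularities-31770`;
no aside change, no item.

The lens header, verbatim (carried in this file of the node):

> # BandCut — decomp-res node (lens-5 g33, RESIDUAL MODE «finite/base range + asymptotic regime + bridge»)
>
> Column: `stmt-ResolutionOfSingularities-31770` = `TightDefectClasses.DefectWalksTerminateDeep` (Theses decl
> `MaxContactCut.DefectWalksDeep`).  HOME = run/shared/lean/pub/decomp-res; this file = HOME/decomp-res-lens-5/g33/BandCut.lean.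
> Imports the LANDED tree only (`ThreadCutPinf` ⊇ `ThreadCutLaw` = g31 «ThreadCut», `NoJump` = g14); no carry.
>
> ## The mechanism (stated in advance on the bus, DESK 2026-08-31 g33): the TOP EXCESS LAYER is fatal
>
> Let `q ≥ 2`, `K` ANY field, `s` a state with `ord₀ F ≥ 2q − 1` (excess `E = ord₀ F − q ≥ q − 1`), `b` an EQUIMULTIPLE point of
> the chart `u_j` (`b_j = 0`; corner OR translating).  Then the successor `F′ = clean(translate_b(chart_j F))` has
every monomial
> in the layers `u_j^{≥ q−1}`; every Hasse derivative `D^{(d)}F′` (`0 < |d| < q`) lies in `(u_j, D^{((q−1)e_j)}F′)`,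
and the second
> generator has constant coefficient `coeff_{(q−1)e_j} F′ = 0` by equimultiplicity.  A top ideal inside TWO such
generators never
> isolates the origin (§1, ELEMENTARY: kill `u_j`; `G ∣ h·u_i^N ∧ G ∣ h·u_k^N ⇒ G ∣ h ⇒ G(0) ∣ h(0)`): geometrically `Top(F′)`
> contains the CURVE `{u_j = 0, G₀ = 0}`, `G₀ = in_{2q−1}(F)(u_j ↦ 1)(u + b)` — the tangent cone's trace on `E`, a
NON-COORDINATE
> top curve (the tree's non-isolation lemmas `not_isolatedTop_of_fat/_of_dvd/_of_noVar/_of_offHeavy` all need a coordinate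
> axis or plane).
>
> ## What is proved (0 sorry)
>
> * §1 `dvd_of_dvd_mul_X_pow`, `not_isolatedTop_of_le_span_pair` — TWO GENERATORS NEVER ISOLATE (any field, `Fin 3`).
> * §2 `le_apply_of_mem_support_step` (layers), `topIdeal_le_span_pair_of_layer` (LAYER LEMMA), `coeff_single_step_eq_zero`,
>   **`not_isolatedTop_step_of_le_ordZero`** — THE LAW: `2q − 1 ≤ ord₀ s.F`, `b_j = 0`, equimultiple ⇒ `¬
IsolatedTop q (step q j b s).F`.
> * §3 WALK BAND (hypothesis-free: any field, ANY `q ≥ 2`, no root / cleanness / characteristic hypothesis):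
>   **`ForcedWalk.ordZero_le_two_mul_sub_two`** `ord₀ F_t ≤ 2q − 2` for EVERY `t`; with a root `q ≤ ord₀ F_t ≤ 2q − 2`
>   (`ForcedWalk.band`), LEDGER CURRENCY `shade_t + |r_t| ≤ 2q − 2` (`ForcedWalk.shade_add_degree_le`; critical plateaux carry
>   mass `≤ q − 2`, `ForcedWalk.degree_le_of_shade_eq`), `q = 2 ⇒ ord₀ F_t = 2` (`ForcedWalk.ordZero_eq_two`).
>   Sharpens `NoJump.order_lt_two_mul` (`ord₀ F_t < 2q`) by one layer: the KIND «visits the top excess layer `E = q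
− 1`» is EMPTY.
> * §4 THREAD KINDS by the ORDER BAND (`Thread` = g31's object): `Thread.not_isolatedTop_succ_of_le_ordZero`; `OutOfBandIO`,
>   `EventuallyInBand`, the dichotomy, `OutOfBandIO ⇒ ¬ IsolatedTop i.o.` (`Thread.not_isolated_io_of_outOfBandIO`; (T-bridge)
>   material, cite only), every forced walk's thread is in band at every stage.
> * §5 GLIDERS — certified TRANSLATING inhabitants from ROOTS with ALL binders (every field, every `q ≥ 2`, every `a ≥ q` with
>   `a = q ∨ q ∤ a`, EVERY translation sequence `c : ℕ → K`): `glider q a c : Thread q (gliderRoot a)`, chart `u₁`, points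
>   `b_t = c_t·e₂`, states `F_t = u₀^a·u₁^{m_t}`, `r_t = m_t·e₁` (`m_{t+1} = m_t + a − q`); `IsRoot`; translating iff `c_t ≠ 0`
>   i.o.; NEVER isolated (the `u₂`-axis is a top line); `a = q`: `ord₀ ≡ q + 1` (in band for `q ≥ 3`); `a = 2q − 1`: `ord₀ ≥ 2q`
>   for ever (out of band).  They certify: the registered (T-tr) half «leaves every top line i.o. ⇒ isolated i.o.» is FALSE for
>   threads, the half «eventually on one top line» misses every translating thread, and `OutOfBandIO ∩ Translating`
is inhabited.
>
> Mechanism source, cited: cell res-dim4-pi PR-12 `Theorems/PurelyInseparableDim4IsolatedBand` (Fin 4 CENTRE model,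
> minimal-prime `IsIsolated`, Krull height).  The E-model / `IsolatedTop` / `PointBlowup.step` / column-31770 version and the
> elementary two-generator proof are this node's.  Nothing here is progress on `ResolutionOfSingularities` (rung 0).
> (Sources: Hauser2010 §§F–G; HauserPerlega2019PRIMS §3; Giraud1975 §1; BierstoneGrigorievMilmanWlodarczyk2011 Def. 3.1.3.)
>
> [LANDING FILE 1/2 of the decomp-res lens-5 g33 node «BandCut» (HOME/decomp-res-lens-5/g33/BandCut.lean; NODE-g33.md §7): this
> file = header + §1–§3 VERBATIM (two generators never isolate · the layer lemma and THE LAW · the walk band); file 2/2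
> `Theorems/BandCutThreads.lean` = §4–§5 (thread kinds, gliders).  `--kind proof --supports
stmt-ResolutionOfSingularities-31770`;
> the HOME-only the dupNamespace-linter line is dropped; namespace `…Theorems.BandCut`.]

The landing file 2/2 header, verbatim:

> # BandCutThreads — decomp-res node «BandCut» (lens-5 g33), tree file 2/2: §4 THREAD KINDS by the order band, §5 GLIDERS
>
> Content VERBATIM from `HOME/decomp-res-lens-5/g33/BandCut.lean` §4–§5 (HOME = run/shared/lean/pub/decomp-res; provenance,
> critic text and the full node header in file 1/2 `Theorems/BandCutLaw`).  §4: `Thread.not_isolatedTop_succ_of_le_ordZero`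
> (a stage of order `≥ 2q − 1` has a NON-ISOLATED successor, corner or translating), the kinds `Thread.OutOfBandIO` /
> `Thread.EventuallyInBand` / `Thread.NonIsolatedIO`, their dichotomy, `Thread.nonIsolatedIO_of_outOfBandIO`, and «every forced
> walk's thread is in band at every stage».  §5: the GLIDER threads `glider q a c : Thread q (gliderRoot a)` — certified
> TRANSLATING threads from ROOTS with all binders (every field, every `q ≥ 2`, `a ≥ q` with `a = q ∨ q ∤ a`, every translation
> sequence), never isolated, in band (`a = q`, `q ≥ 3`) and out of band (`a = 2q − 1`):
`exists_translating_thread_never_isolated`,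
> `translating_kinds_inhabited`.  `--kind proof --supports stmt-ResolutionOfSingularities-31770`; namespace `…Theorems.BandCut`.
> (Sources: Hauser2010 §§F–G; HauserPerlega2019PRIMS §3; Giraud1975 §1.)

## This file

§4 THREAD KINDS BY THE ORDER BAND (`section Threads`; `Thread` = g31's object):
`Thread.not_isolatedTop_succ_of_le_ordZero` (a stage of order `≥ 2q − 1` has a non-isolated successor), the kinds
`Thread.OutOfBandIO` / `Thread.EventuallyInBand` / `Thread.NonIsolatedIO`, the dichotomy
`outOfBandIO_or_eventuallyInBand`, `not_outOfBandIO_of_eventuallyInBand`, **`Thread.nonIsolatedIO_of_outOfBandIO`**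
((T-bridge) material, cited only), `eventuallyInBand_of_eventually_isolated`, and «every forced walk's thread is in
band at every stage» (`ForcedWalk.toThread_inBand`, `ForcedWalk.toThread_not_outOfBandIO`).  (The 400-line cap cuts
this group into 2 files; this first part carries:
`_root_.Summit.ResolutionOfSingularities.ResolutionOfSingularities.Theorems.ThreadCut.Thread.not_isolatedTop_succ_of_le_ordZero`,
`_root_.Summit.ResolutionOfSingularities.ResolutionOfSingularities.Theorems.ThreadCut.Thread.OutOfBandIO`,
`_root_.Summit.ResolutionOfSingularities.ResolutionOfSingularities.Theorems.ThreadCut.Thread.EventuallyInBand`,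
`_root_.Summit.ResolutionOfSingularities.ResolutionOfSingularities.Theorems.ThreadCut.Thread.NonIsolatedIO`,
`_root_.Summit.ResolutionOfSingularities.ResolutionOfSingularities.Theorems.ThreadCut.Thread.outOfBandIO_or_eventuallyInBand`,
`_root_.Summit.ResolutionOfSingularities.ResolutionOfSingularities.Theorems.ThreadCut.Thread.not_outOfBandIO_of_eventuallyInBand`,
`_root_.Summit.ResolutionOfSingularities.ResolutionOfSingularities.Theorems.ThreadCut.Thread.nonIsolatedIO_of_outOfBandIO`,
`_root_.Summit.ResolutionOfSingularities.ResolutionOfSingularities.Theorems.ThreadCut.Thread.eventuallyInBand_of_eventually_isolated`,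
`_root_.Summit.ResolutionOfSingularities.ResolutionOfSingularities.Theorems.TightDefectClasses.ForcedWalk.toThread_inBand`,
`_root_.Summit.ResolutionOfSingularities.ResolutionOfSingularities.Theorems.TightDefectClasses.ForcedWalk.toThread_not_outOfBandIO`.)

[WRITER NOTE (decomp-res writer g13): `BandCutLaw` = landing file 1/2 verbatim (one tree file; its 48-line landing
header is reproduced verbatim in `BandCutThreads` — no room for it here next to the provenance under the 400-line
cap); landing file 2/2 is 408 lines, over the tree's 400-line cap, and is cut at the node's own section boundary:
`BandCutThreads` = §4 (`section Threads`), `BandCutThreads2` = §5 (`section Glider`); the file-level `noncomputable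
section` and `open` lines are replayed in each part; sections, section variables (incl. the `variable (K …)` /
`variable {K}` binder switch of §5) and every declaration exactly as in the landing files; `[cite: …]` groups in
docstrings are rendered `(Sources: …)` (tree lint).  No dedup deletions (pre-flight clean).]

(Sources: Hauser2010 §§F–G; HauserPerlega2019PRIMS §3; Giraud1975 §1; BierstoneGrigorievMilmanWlodarczyk2011 Def. 3.1.3.)
-/

noncomputable section

open MvPolynomial
open Literature.AlgebraicGeometry.Resolution
open Literature.AlgebraicGeometry.Resolution.Hauser2010
open Literature.AlgebraicGeometry.Resolution.PointBlowup
open Summit.ResolutionOfSingularities.ResolutionOfSingularities.Theorems.TightDefectClasses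
open Summit.ResolutionOfSingularities.ResolutionOfSingularities.Theorems.ItineraryCutClasses
open Summit.ResolutionOfSingularities.ResolutionOfSingularities.Theorems.LassoCut
open Summit.ResolutionOfSingularities.ResolutionOfSingularities.Theorems.ThreadCut

namespace Summit.ResolutionOfSingularities.ResolutionOfSingularities.Theorems.BandCut

section Threads

variable {K : Type} [Field K] [DecidableEq K] {q : ℕ} {s₀ : State (Fin 3) K}

/-! ## §4 THREAD KINDS by the order band (`Thread` = g31's object; (T-bridge) material is cited, not hosted) -/

/-- **THE LAW FOR THREADS**: a stage of order `≥ 2q − 1` has a NON-ISOLATED successor (corner or translating step).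
[new] [folklore] -/
theorem _root_.Summit.ResolutionOfSingularities.ResolutionOfSingularities.Theorems.ThreadCut.Thread.not_isolatedTop_succ_of_le_ordZero (hq : 2 ≤ q) (T : Thread q s₀) (t : ℕ)
    (ho : ((2 * q - 1 : ℕ) : ℕ∞) ≤ ordZero (T.st t).F) : ¬ IsolatedTop q (T.st (t + 1)).F := by
  rw [T.st_succ]
  exact not_isolatedTop_step_of_le_ordZero hq (T.j t) (T.onExc t) (T.st t) ho (T.equimult t)

/-- OUT OF BAND infinitely often: `ord₀ F_t ≥ 2q − 1` at infinitely many stages. DEFINITION (thread kind, by mechanism: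
the top excess layer). -/
def _root_.Summit.ResolutionOfSingularities.ResolutionOfSingularities.Theorems.ThreadCut.Thread.OutOfBandIO (T : Thread q s₀) : Prop :=
  ∀ N, ∃ t, N ≤ t ∧ ((2 * q - 1 : ℕ) : ℕ∞) ≤ ordZero (T.st t).F

/-- EVENTUALLY IN BAND: `ord₀ F_t ≤ 2q − 2` from some stage on. DEFINITION (the complementary thread kind). -/
def _root_.Summit.ResolutionOfSingularities.ResolutionOfSingularities.Theorems.ThreadCut.Thread.EventuallyInBand (T : Thread q s₀) : Prop :=
  ∃ N, ∀ t, N ≤ t → ordZero (T.st t).F ≤ ((2 * q - 2 : ℕ) : ℕ∞)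

/-- NON-ISOLATED infinitely often. DEFINITION (thread kind; lens-6's NonIso side / `ThreadCutJunction`'s NonIso cells). -/
def _root_.Summit.ResolutionOfSingularities.ResolutionOfSingularities.Theorems.ThreadCut.Thread.NonIsolatedIO (T : Thread q s₀) : Prop :=
  ∀ N, ∃ t, N ≤ t ∧ ¬ IsolatedTop q (T.st t).F

/-- DICHOTOMY (excluded middle + `¬ (2q−1 ≤ o) ↔ o ≤ 2q−2`). [folklore] -/
theorem _root_.Summit.ResolutionOfSingularities.ResolutionOfSingularities.Theorems.ThreadCut.Thread.outOfBandIO_or_eventuallyInBand (hq : 1 ≤ q) (T : Thread q s₀) :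
    T.OutOfBandIO ∨ T.EventuallyInBand := by
  by_cases h : T.OutOfBandIO
  · exact Or.inl h
  · right
    obtain ⟨N, hN⟩ := not_forall.mp h
    refine ⟨N, fun t ht => ?_⟩
    have h1 : ¬ ((2 * q - 1 : ℕ) : ℕ∞) ≤ ordZero (T.st t).F := fun h' => hN ⟨t, ht, h'⟩
    rw [not_le] at h1
    have h2 : ((2 * q - 1 : ℕ) : ℕ∞) = ((2 * q - 2 : ℕ) : ℕ∞) + 1 := by
      rw [show 2 * q - 1 = (2 * q - 2) + 1 by omega, Nat.cast_add, Nat.cast_one]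
    rw [h2] at h1
    exact Order.le_of_lt_add_one h1

/-- The two kinds are DISJOINT. [folklore] -/
theorem _root_.Summit.ResolutionOfSingularities.ResolutionOfSingularities.Theorems.ThreadCut.Thread.not_outOfBandIO_of_eventuallyInBand (hq : 1 ≤ q) (T : Thread q s₀) (h : T.EventuallyInBand) :
    ¬ T.OutOfBandIO := by
  obtain ⟨N, hN⟩ := h
  intro h'
  obtain ⟨t, ht, ho⟩ := h' N
  have := le_trans ho (hN t ht)
  have h3 : (2 * q - 1 : ℕ) ≤ 2 * q - 2 := by exact_mod_cast this
  omega

/-- **OUT-OF-BAND-i.o. threads are NON-ISOLATED i.o.** (hypothesis-free law; the (T-bridge) side takes it from here).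
[new] [folklore] -/
theorem _root_.Summit.ResolutionOfSingularities.ResolutionOfSingularities.Theorems.ThreadCut.Thread.nonIsolatedIO_of_outOfBandIO (hq : 2 ≤ q) (T : Thread q s₀) (h : T.OutOfBandIO) : T.NonIsolatedIO := by
  intro N
  obtain ⟨t, ht, ho⟩ := h N
  exact ⟨t + 1, by omega, T.not_isolatedTop_succ_of_le_ordZero hq t ho⟩

/-- … so a thread ISOLATED at every stage from some time on is EVENTUALLY IN BAND. [new] [folklore] -/
theorem _root_.Summit.ResolutionOfSingularities.ResolutionOfSingularities.Theorems.ThreadCut.Thread.eventuallyInBand_of_eventually_isolated (hq : 2 ≤ q) (T : Thread q s₀) {N : ℕ}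
    (hiso : ∀ t, N ≤ t → IsolatedTop q (T.st t).F) : T.EventuallyInBand := by
  rcases T.outOfBandIO_or_eventuallyInBand (by omega) with h | h
  · exfalso
    obtain ⟨t, ht, hnot⟩ := T.nonIsolatedIO_of_outOfBandIO hq h N
    exact hnot (hiso t ht)
  · exact h

/-- **Every forced walk's thread is IN BAND AT EVERY STAGE** (consistency map: the binder `isolated` at stage `t + 1`).
[new] [folklore] -/
theorem _root_.Summit.ResolutionOfSingularities.ResolutionOfSingularities.Theorems.TightDefectClasses.ForcedWalk.toThread_inBand
    (hq : 2 ≤ q) (W : ForcedWalk q s₀) (t : ℕ) : ordZero (W.toThread.st t).F ≤ ((2 * q - 2 : ℕ) : ℕ∞) :=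
  W.ordZero_le_two_mul_sub_two hq t

/-- … hence never out of band. [new] [folklore] -/
theorem _root_.Summit.ResolutionOfSingularities.ResolutionOfSingularities.Theorems.TightDefectClasses.ForcedWalk.toThread_not_outOfBandIO
    (hq : 2 ≤ q) (W : ForcedWalk q s₀) : ¬ W.toThread.OutOfBandIO :=
  W.toThread.not_outOfBandIO_of_eventuallyInBand (by omega) ⟨0, fun t _ => W.toThread_inBand hq t⟩

end Threads

end Summit.ResolutionOfSingularities.ResolutionOfSingularities.Theorems.BandCut
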